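import Literature.Barriers.QuantumAdvantage.TensorNetworkContractionPathDecompositionLists
import Literature.Computability.Complexity.CodeFPListKit
import Literature.Computability.Complexity.CodeFPBudgets
import Literature.Computability.Cryptography.QuantumCircuitDescFP
import HarnessLib

/-!
# Barrier catalogue `QuantumAdvantage` — the path decomposition is printed in polynomial time; Prop 5.1 from Thm 4.6

Companion to `TensorNetworkContractionPathDecompositionLists.lean` (the parent list and the bag
code lists `bagCodes` of the rooted path decomposition `pathDecomp σ C`, by elementary list
operations on the position list of `σ` and the wire lists of the gates; `encode_pathDecomp`).
Here those list operations are realised on codes (`CodeFP`, `Complexity/CodeFP*.lean`) and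
composed with the description function of a uniform family (`QuantumCircuitDescFP.lean`) and the
supplied ordering function: **`exists_pathSupplier`** — for a uniform Clifford+`T` family and an
`FP` function supplying orderings `σ_n` of cut parameter `≤ c·log₂ n + c`, an `FP` function
`1ⁿ ↦ 𝒯_n` supplies rooted tree decompositions of the circuit graphs of width
`≤ (2c+2)·log₂ n + (2c+2)` in the code `RootedTreeDecomposition.encode`. Hence
**`markovShi2008_prop51_of_thm46'`**: the contraction theorem `markovShi2008_thm46`
(Thm 4.6 with the decomposition supplied) implies `markovShi2008_prop51` (Prop 5.1 with the
ordering supplied) — no Robertson–Seymour step.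

## References

* [MarkovShi2008] I. L. Markov, Y. Shi, SIAM J. Comput. 38 (2008) 963–981, §5 (Prop 5.1), §4 (Thm 4.6).
* [AroraBarak2009] S. Arora, B. Barak, *Computational Complexity*, CUP 2009, §1.3, §6.2.
-/

noncomputable section

namespace Literature.Barriers.QuantumAdvantage

open Literature.Computability.Cryptography Literature.Combinatorics.SimpleGraph
  Literature.Computability.Complexity Literature.Computability.Complexity.CodeFP
  Literature.Computability.Complexity.Brick Polynomial _root_.Computability

/-! ### The list primitives on codes -/

namespace PathFP

/-- `posOf` on codes (input `(pos, w)`). [cite: AroraBarak2009, §1.3] -/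
theorem posOfFP : CodeFP (pairE (rawE natE) natE) natE (fun p => posOf p.1 p.2) :=
  (rawGetD natE (d := 0) rfl).congr fun _ => rfl

/-- A right fold of a commutative associative operation is a left fold. [folklore] -/
theorem foldr_eq_foldl_of_comm {op : ℕ → ℕ → ℕ} (hc : ∀ a b, op a b = op b a) (ha : ∀ a b c, op (op a b) c = op a (op b c)) :
    ∀ (l : List ℕ) (a : ℕ), l.foldr op a = l.foldl op a
  | [], a => rfl
  | x :: l, a => by
    rw [List.foldr_cons, List.foldl_cons, foldr_eq_foldl_of_comm hc ha l a]
    -- `op x (foldl op a l) = foldl op (op a x) l`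
    induction l generalizing a with
    | nil => exact hc x a
    | cons y l ih =>
      rw [List.foldl_cons, List.foldl_cons, ih (op a y), ha, hc y x, ← ha]

/-- `gMin` on codes (input `((pos, N), ws)`). [cite: AroraBarak2009, §1.3] -/
theorem gMinFP : CodeFP (pairE (pairE (rawE natE) natE) (rawE natE)) natE (fun p => gMin p.1.1 p.1.2 p.2) := by
  have hposs := map (σ := List ℕ) (eσ := rawE natE) (eα := natE) (eβ := natE) (g := fun t => posOf t.1 t.2) posOfFP
  have hL : CodeFP (pairE (pairE (rawE natE) natE) (rawE natE)) (rawE natE) (fun p => p.2.map (posOf p.1.1)) :=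
    hposs.comp ((fst _ _).fst'.pair (snd _ _))
  have hfold := foldl (σ := ℕ) (eσ := natE) (α := ℕ) (eα := natE) (β := ℕ) (eβ := natE)
    (step := fun _ a acc => min acc a) (init := fun N => N) (natMin.comp ((snd _ _).snd'.pair (snd _ _).fst')) (CodeFP.id _)
    X (fun N l₁ l₂ => by
      rw [eval_X]
      have hle : l₁.foldl (fun b a => min b a) N ≤ N := by
        suffices h : ∀ (l : List ℕ) (a : ℕ), l.foldl (fun b a => min b a) a ≤ a from h l₁ N
        intro l; induction l with
        | nil => intro a; exact le_rfl
        | cons x l ih => intro a; exact (ih _).trans (min_le_left _ _)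
      have h1 : (natE (l₁.foldl (fun b a => min b a) N)).length ≤ (natE N).length := by
        rw [length_natE, length_natE]; exact size_mono hle
      simp only [pairE_apply, length_boolPair]; omega)
  refine ((hfold.comp ((fst _ _).snd'.pair hL)).congr fun p => ?_)
  show (p.2.map (posOf p.1.1)).foldl (fun b a => min b a) p.1.2 = gMin p.1.1 p.1.2 p.2
  rw [gMin, foldr_eq_foldl_of_comm min_comm min_assoc]

/-- `gMax` on codes (input `(pos, ws)`). [cite: AroraBarak2009, §1.3] -/
theorem gMaxFP : CodeFP (pairE (rawE natE) (rawE natE)) natE (fun p => gMax p.1 p.2) := by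
  have hposs := map (σ := List ℕ) (eσ := rawE natE) (eα := natE) (eβ := natE) (g := fun t => posOf t.1 t.2) posOfFP
  have hfold := foldl₀ (eα := natE) (eβ := natE) (step := fun a acc => max acc a) (b₀ := 0)
    (natMax.comp ((snd _ _).pair (fst _ _))) X (fun l₁ l₂ => by
      rw [eval_X]
      have hle : ∀ (l : List ℕ) (a : ℕ), (∀ x ∈ l, (natE x).length ≤ (rawE natE (l₁ ++ l₂)).length) →
          (natE a).length ≤ (rawE natE (l₁ ++ l₂)).length →
          (natE (l.foldl (fun b a => max b a) a)).length ≤ (rawE natE (l₁ ++ l₂)).length := by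
        intro l; induction l with
        | nil => intro a _ ha; exact ha
        | cons x l ih =>
          intro a hx ha
          refine ih _ (fun y hy => hx y (List.mem_cons_of_mem _ hy)) ?_
          show (natE (max a x)).length ≤ _
          rcases le_total a x with h | h
          · rw [max_eq_right h]; exact hx x List.mem_cons_self
          · rw [max_eq_left h]; exact ha
      refine hle l₁ 0 (fun x hx => ?_) (by simp)
      have := length_item_le_length_rawE natE (List.mem_append_left l₂ hx); omega)
  refine ((hfold.comp hposs).congr fun p => ?_)
  show (p.2.map (posOf p.1)).foldl (fun b a => max b a) 0 = gMax p.1 p.2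
  rw [gMax, foldr_eq_foldl_of_comm max_comm max_assoc]

/-- The wire list of gate `t` (input `(wl, t)`). [cite: AroraBarak2009, §1.3] -/
theorem wlGetFP : CodeFP (pairE (rawE (rawE natE)) natE) (rawE natE) (fun p => p.1.getD p.2 []) :=
  rawGetD (rawE natE) (d := []) rfl

/-- The crossing test of gate `t` at the cut after `i` (input `(((pos, N), wl), (i, t))`).
[cite: AroraBarak2009, §1.3] -/
theorem crossTestFP : CodeFP (pairE (pairE (pairE (rawE natE) natE) (rawE (rawE natE))) (pairE natE natE)) bitE
    (fun p => decide (gMin p.1.1.1 p.1.1.2 (p.1.2.getD p.2.2 []) ≤ p.2.1 ∧ p.2.1 < gMax p.1.1.1 (p.1.2.getD p.2.2 []))) := by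
  have hws : CodeFP (pairE (pairE (pairE (rawE natE) natE) (rawE (rawE natE))) (pairE natE natE)) (rawE natE)
      (fun p => p.1.2.getD p.2.2 []) := wlGetFP.comp ((fst _ _).snd'.pair (snd _ _).snd')
  have hmin : CodeFP (pairE (pairE (pairE (rawE natE) natE) (rawE (rawE natE))) (pairE natE natE)) natE
      (fun p => gMin p.1.1.1 p.1.1.2 (p.1.2.getD p.2.2 [])) := gMinFP.comp ((fst _ _).fst'.pair hws)
  have hmax : CodeFP (pairE (pairE (pairE (rawE natE) natE) (rawE (rawE natE))) (pairE natE natE)) natE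
      (fun p => gMax p.1.1.1 (p.1.2.getD p.2.2 [])) := gMaxFP.comp ((fst _ _).fst'.fst'.pair hws)
  have hi : CodeFP (pairE (pairE (pairE (rawE natE) natE) (rawE (rawE natE))) (pairE natE natE)) natE (fun p => p.2.1) :=
    (snd _ _).fst'
  exact ((natLe.comp (hmin.pair hi)).and (natLt.comp (hi.pair hmax))).congr fun p => by simp [Bool.decide_and]

/-- **`crossCodes` on codes** (input `(((pos, N), wl), i)`). [cite: AroraBarak2009, §1.3] -/
theorem crossCodesFP : CodeFP (pairE (pairE (pairE (rawE natE) natE) (rawE (rawE natE))) natE) (rawE natE)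
    (fun p => crossCodes p.1.1.1 p.1.1.2 p.1.2 p.2) := by
  -- the range of gate positions
  have hrange : CodeFP (pairE (pairE (pairE (rawE natE) natE) (rawE (rawE natE))) natE) (rawE natE)
      (fun p => List.range p.1.2.length) :=
    ((brange (rawE natE)).comp ((fst _ _).snd'.pair ((natLength _).comp (fst _ _).snd'))).congr fun p => by simp
  -- the filter, context `c = ((pos, N), wl, i)`
  have hfilt := filter (σ := ((List ℕ × ℕ) × List (List ℕ)) × ℕ)
    (eσ := pairE (pairE (pairE (rawE natE) natE) (rawE (rawE natE))) natE) (eα := natE)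
    (p := fun q => decide (gMin q.1.1.1.1 q.1.1.1.2 (q.1.1.2.getD q.2 []) ≤ q.1.2 ∧ q.1.2 < gMax q.1.1.1.1 (q.1.1.2.getD q.2 [])))
    (crossTestFP.comp ((fst _ _).fst'.pair ((fst _ _).snd'.pair (snd _ _))))
  have hadd := map (σ := ℕ) (eσ := natE) (eα := natE) (eβ := natE) (g := fun t => t.1 + t.2) natAdd
  refine ((hadd.comp ((fst _ _).fst'.snd'.pair (hfilt.comp ((CodeFP.id _).pair hrange)))).congr fun p => ?_)
  rfl

/-- `gateTimesOn` on codes (input `(wl, w)`). [cite: AroraBarak2009, §1.3] -/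
theorem gateTimesOnFP : CodeFP (pairE (rawE (rawE natE)) natE) (rawE natE) (fun p => gateTimesOn p.1 p.2) := by
  have hrange : CodeFP (pairE (rawE (rawE natE)) natE) (rawE natE) (fun p => List.range p.1.length) :=
    ((brange (rawE natE)).comp ((fst _ _).pair ((natLength _).comp (fst _ _)))).congr fun p => by simp
  have htest : CodeFP (pairE (pairE (rawE (rawE natE)) natE) natE) bitE (fun q => decide (q.1.2 ∈ q.1.1.getD q.2 [])) :=
    (mem natE_injective).comp ((fst _ _).snd'.pair (wlGetFP.comp ((fst _ _).fst'.pair (snd _ _))))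
  exact ((filter htest).comp ((CodeFP.id _).pair hrange)).congr fun p => rfl

/-- `getLast?` of a raw list. [folklore] -/
theorem rawGetLast? : CodeFP (rawE natE) (optE natE) List.getLast? :=
  ((rawHead? natE).comp (rawReverse natE)).congr fun l => by rw [List.head?_reverse]

/-- **`lastCode` on codes** (input `((N, wl), (w, j))`). [cite: AroraBarak2009, §1.3] -/
theorem lastCodeFP : CodeFP (pairE (pairE natE (rawE (rawE natE))) (pairE natE natE)) natE
    (fun p => lastCode p.1.1 p.1.2 p.2.1 p.2.2) := by
  have hg : CodeFP (pairE (pairE natE (rawE (rawE natE))) (pairE natE natE)) (rawE natE) (fun p => gateTimesOn p.1.2 p.2.1) :=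
    gateTimesOnFP.comp ((fst _ _).snd'.pair (snd _ _).fst')
  have hfilt := filter (σ := ℕ) (eσ := natE) (eα := natE) (p := fun q => decide (q.2 + 1 ≤ q.1))
    (natLe.comp ((natAdd.comp ((snd _ _).pair (const _ 1))).pair (fst _ _)))
  have hS : CodeFP (pairE (pairE natE (rawE (rawE natE))) (pairE natE natE)) (rawE natE)
      (fun p => (gateTimesOn p.1.2 p.2.1).filter fun t => decide (t + 1 ≤ p.2.2)) := (hfilt.comp ((snd _ _).snd'.pair hg)).congr fun _ => rfl
  have hlast := rawGetLast?.comp hS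
  have hcase := optCases (σ := ℕ × ℕ) (eσ := pairE natE natE) (eα := natE) (eδ := natE)
    (k := fun c o => match o with | some t => c.1 + t | none => c.2) (gnone := fun c => c.2) (gsome := fun t => t.1.1 + t.2)
    (snd _ _) (natAdd.comp ((fst _ _).fst'.pair (snd _ _))) (fun _ => rfl) (fun _ _ => rfl)
  refine ((hcase.comp (((fst _ _).fst'.pair (snd _ _).fst').pair hlast)).congr fun p => ?_)
  show (match ((gateTimesOn p.1.2 p.2.1).filter fun t => decide (t + 1 ≤ p.2.2)).getLast? with
    | some t => p.1.1 + t | none => p.2.1) = lastCode p.1.1 p.1.2 p.2.1 p.2.2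
  unfold lastCode
  rcases ((gateTimesOn p.1.2 p.2.1).filter fun t => decide (t + 1 ≤ p.2.2)).getLast? with _ | t <;> rfl

/-- **`firstCode` on codes** (input `((N, wl), (w, j))`). [cite: AroraBarak2009, §1.3] -/
theorem firstCodeFP : CodeFP (pairE (pairE natE (rawE (rawE natE))) (pairE natE natE)) natE
    (fun p => firstCode p.1.1 p.1.2 p.2.1 p.2.2) := by
  have hg : CodeFP (pairE (pairE natE (rawE (rawE natE))) (pairE natE natE)) (rawE natE) (fun p => gateTimesOn p.1.2 p.2.1) :=
    gateTimesOnFP.comp ((fst _ _).snd'.pair (snd _ _).fst')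
  have hfilt := filter (σ := ℕ) (eσ := natE) (eα := natE) (p := fun q => decide (q.1 < q.2 + 1))
    (natLt.comp ((fst _ _).pair (natAdd.comp ((snd _ _).pair (const _ 1)))))
  have hS : CodeFP (pairE (pairE natE (rawE (rawE natE))) (pairE natE natE)) (rawE natE)
      (fun p => (gateTimesOn p.1.2 p.2.1).filter fun t => decide (p.2.2 < t + 1)) := (hfilt.comp ((snd _ _).snd'.pair hg)).congr fun _ => rfl
  have hhead := (rawHead? natE).comp hS
  -- default `N + T + w`
  have hdef : CodeFP (pairE (pairE natE (rawE (rawE natE))) (pairE natE natE)) natE (fun p => p.1.1 + p.1.2.length + p.2.1) :=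
    natAdd.comp ((natAdd.comp ((fst _ _).fst'.pair ((natLength _).comp (fst _ _).snd'))).pair (snd _ _).fst')
  have hcase := optCases (σ := ℕ × ℕ) (eσ := pairE natE natE) (eα := natE) (eδ := natE)
    (k := fun c o => match o with | some t => c.1 + t | none => c.2) (gnone := fun c => c.2) (gsome := fun t => t.1.1 + t.2)
    (snd _ _) (natAdd.comp ((fst _ _).fst'.pair (snd _ _))) (fun _ => rfl) (fun _ _ => rfl)
  refine ((hcase.comp (((fst _ _).fst'.pair hdef).pair hhead)).congr fun p => ?_)
  show (match ((gateTimesOn p.1.2 p.2.1).filter fun t => decide (p.2.2 < t + 1)).head? with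
    | some t => p.1.1 + t | none => p.1.1 + p.1.2.length + p.2.1) = firstCode p.1.1 p.1.2 p.2.1 p.2.2
  unfold firstCode
  rcases ((gateTimesOn p.1.2 p.2.1).filter fun t => decide (p.2.2 < t + 1)).head? with _ | t <;> rfl

/-- `wireAt` on codes (input `(pos, i)`). [cite: AroraBarak2009, §1.3] -/
theorem wireAtFP : CodeFP (pairE (rawE natE) natE) natE (fun p => wireAt p.1 p.2) := by
  have h := findIdxFP (σ := ℕ) (eσ := natE) (eα := natE) (p := fun q => q.2 == q.1)
    ((beq natE_injective).comp ((snd _ _).pair (fst _ _)))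
  refine ((h.comp ((snd _ _).pair (fst _ _))).congr fun p => ?_)
  show p.1.findIdx (fun a => a == p.2) = wireAt p.1 p.2
  rw [wireAt, List.idxOf]

/-- `insSD` on codes (input `(acc, x)`). [cite: AroraBarak2009, §1.3] -/
theorem insSDFP : CodeFP (pairE (rawE natE) natE) (rawE natE) (fun p => insSD p.1 p.2) := by
  have hlt := filter (σ := ℕ) (eσ := natE) (eα := natE) (p := fun q => decide (q.2 < q.1)) (natLt.comp ((snd _ _).pair (fst _ _)))
  have hgt := filter (σ := ℕ) (eσ := natE) (eα := natE) (p := fun q => decide (q.1 < q.2)) (natLt.comp ((fst _ _).pair (snd _ _)))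
  have h1 : CodeFP (pairE (rawE natE) natE) (rawE natE) (fun p => p.1.filter fun c => decide (c < p.2)) := hlt.comp ((snd _ _).pair (fst _ _))
  have h2 : CodeFP (pairE (rawE natE) natE) (rawE natE) (fun p => p.1.filter fun c => decide (p.2 < c)) := hgt.comp ((snd _ _).pair (fst _ _))
  exact ((rawAppend natE).comp (h1.pair ((rawCons natE).comp ((snd _ _).pair h2)))).congr fun p => rfl

/-- The sorted accumulator has no repetition and lies in the prefix. [folklore] -/
theorem foldl_insSD_nodup_subset (l₁ : List ℕ) : (l₁.foldl insSD []).Nodup ∧ ∀ c ∈ l₁.foldl insSD [], c ∈ l₁ := by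
  obtain ⟨h1, h2⟩ := foldl_insSD_spec l₁ [] List.Pairwise.nil
  exact ⟨h1.imp fun h => h.ne, fun c hc => by simpa using (h2 c).1 hc⟩

/-- **`sortDedup` on codes.** [cite: AroraBarak2009, §1.3] -/
theorem sortDedupFP : CodeFP (rawE natE) (rawE natE) sortDedup := by
  have h := foldl₀ (eα := natE) (eβ := rawE natE) (step := fun x acc => insSD acc x) (b₀ := [])
    (insSDFP.comp ((snd _ _).pair (fst _ _))) X (fun l₁ l₂ => by
    rw [eval_X]
    obtain ⟨hnd, hsub⟩ := foldl_insSD_nodup_subset l₁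
    exact (length_rawE_le_of_nodup_subset natE hnd hsub).trans (length_rawE_le_of_sublist natE (List.sublist_append_left l₁ l₂)))
  exact h.congr fun l => rfl

/-- The code of the data `(pos, (N, wl))` (`N` unary). [folklore] -/
abbrev datE : List ℕ × (ℕ × List (List ℕ)) → List Bool := pairE (rawE natE) (pairE unE (rawE (rawE natE)))

/-- **`bagCodes` on codes** (input `((pos, (N, wl)), (i, j))`). [cite: AroraBarak2009, §1.3] -/
theorem bagCodesFP : CodeFP (pairE datE (pairE natE natE)) (rawE natE) (fun q => bagCodes q.1.1 q.1.2.1 q.1.2.2 q.2.1 q.2.2) := by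
  have hpos : CodeFP (pairE datE (pairE natE natE)) (rawE natE) (fun q => q.1.1) := (fst _ _).fst'
  have hN : CodeFP (pairE datE (pairE natE natE)) natE (fun q => q.1.2.1) := (natOfUn.comp (fst _ _).snd'.fst').congr fun _ => rfl
  have hwl : CodeFP (pairE datE (pairE natE natE)) (rawE (rawE natE)) (fun q => q.1.2.2) := (fst _ _).snd'.snd'
  have hi : CodeFP (pairE datE (pairE natE natE)) natE (fun q => q.2.1) := (snd _ _).fst'
  have hj : CodeFP (pairE datE (pairE natE natE)) natE (fun q => q.2.2) := (snd _ _).snd'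
  have hi1 : CodeFP (pairE datE (pairE natE natE)) natE (fun q => q.2.1 - 1) := natSub.comp (hi.pair (const _ 1))
  have hctx : CodeFP (pairE datE (pairE natE natE)) (pairE (pairE (rawE natE) natE) (rawE (rawE natE))) (fun q => ((q.1.1, q.1.2.1), q.1.2.2)) :=
    (hpos.pair hN).pair hwl
  have hc1 : CodeFP (pairE datE (pairE natE natE)) (rawE natE) (fun q => crossCodes q.1.1 q.1.2.1 q.1.2.2 q.2.1) :=
    crossCodesFP.comp (hctx.pair hi)
  have hc2 : CodeFP (pairE datE (pairE natE natE)) (rawE natE) (fun q => crossCodes q.1.1 q.1.2.1 q.1.2.2 (q.2.1 - 1)) :=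
    crossCodesFP.comp (hctx.pair hi1)
  have hw : CodeFP (pairE datE (pairE natE natE)) natE (fun q => wireAt q.1.1 q.2.1) := wireAtFP.comp (hpos.pair hi)
  have hlast : CodeFP (pairE datE (pairE natE natE)) natE (fun q => lastCode q.1.2.1 q.1.2.2 (wireAt q.1.1 q.2.1) q.2.2) :=
    lastCodeFP.comp ((hN.pair hwl).pair (hw.pair hj))
  have hfirst : CodeFP (pairE datE (pairE natE natE)) natE (fun q => firstCode q.1.2.1 q.1.2.2 (wireAt q.1.1 q.2.1) q.2.2) :=
    firstCodeFP.comp ((hN.pair hwl).pair (hw.pair hj))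
  have hlist : CodeFP (pairE datE (pairE natE natE)) (rawE natE)
      (fun q => crossCodes q.1.1 q.1.2.1 q.1.2.2 q.2.1 ++ crossCodes q.1.1 q.1.2.1 q.1.2.2 (q.2.1 - 1) ++
        [lastCode q.1.2.1 q.1.2.2 (wireAt q.1.1 q.2.1) q.2.2, firstCode q.1.2.1 q.1.2.2 (wireAt q.1.1 q.2.1) q.2.2]) :=
    (rawAppend natE).comp (((rawAppend natE).comp (hc1.pair hc2)).pair
      ((rawCons natE).comp (hlast.pair ((rawSingleton natE).comp hfirst))))
  exact (sortDedupFP.comp hlist).congr fun q => rfl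

/-- **The lists printed by the machine**: the parent list `[0, 0, 1, …, k-2]` and the bags in
lexicographic order, `k = N (T + 1)`. [cite: MarkovShi2008, §5 (proof of Prop 5.1)] -/
def pathLists (pos : List ℕ) (N : ℕ) (wl : List (List ℕ)) : List ℕ × List (List ℕ) :=
  ((List.range (N * (wl.length + 1))).map (fun p => p - 1),
   (List.range (N * (wl.length + 1))).map fun p => bagCodes pos N wl (p / (wl.length + 1)) (p % (wl.length + 1)))

/-- **`pathLists` on codes** (output under the list codes `listE`). [cite: AroraBarak2009, §1.3] -/
theorem pathListsFP : CodeFP datE (pairE (listE natE) (listE (listE natE))) (fun q => pathLists q.1 q.2.1 q.2.2) := by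
  -- the range of bag indices: a unit budget of length `N (T + 1)`
  have hunits : CodeFP datE (rawE unitE) (fun q => List.replicate (q.2.1 * (q.2.2.length + 1)) ()) := by
    have hN : CodeFP datE (rawE unitE) (fun q => List.replicate q.2.1 ()) := replicateUnit.comp (snd _ _).fst'
    have hT : CodeFP datE (rawE unitE) (fun q => List.replicate (q.2.2.length + 1) ()) :=
      replicateUnit.comp (unSucc.comp ((ulength _).comp (snd _ _).snd'))
    exact (unitsMul.comp (hN.pair hT)).congr fun q => by simp
  have hrange : CodeFP datE (rawE natE) (fun q => List.range (q.2.1 * (q.2.2.length + 1))) :=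
    ((brange unitE).comp (hunits.pair ((natLength unitE).comp hunits))).congr fun q => by simp
  -- parents
  have hpar : CodeFP datE (rawE natE) (fun q => (List.range (q.2.1 * (q.2.2.length + 1))).map fun p => p - 1) := by
    have hm := map (σ := Unit) (eσ := unitE) (eα := natE) (eβ := natE) (g := fun t => t.2 - 1) (natSub.comp ((snd _ _).pair (const _ 1)))
    exact (hm.comp ((const _ ()).pair hrange)).congr fun q => rfl
  -- bags: context `q`, item `p`
  have hT1 : CodeFP datE natE (fun q => q.2.2.length + 1) := natAdd.comp (((natLength _).comp (snd _ _).snd').pair (const _ 1))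
  have hbag : CodeFP (pairE datE natE) (rawE natE)
      (fun w => bagCodes w.1.1 w.1.2.1 w.1.2.2 (w.2 / (w.1.2.2.length + 1)) (w.2 % (w.1.2.2.length + 1))) := by
    have hT1' : CodeFP (pairE datE natE) natE (fun w => w.1.2.2.length + 1) := hT1.comp (fst _ _)
    exact bagCodesFP.comp ((fst _ _).pair ((natDiv.comp ((snd _ _).pair hT1')).pair (natMod.comp ((snd _ _).pair hT1'))))
  have hbags0 := (map ((listOfRaw natE).comp hbag)).comp ((CodeFP.id datE).pair hrange)
  have hbags : CodeFP datE (rawE (listE natE))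
      (fun q => (List.range (q.2.1 * (q.2.2.length + 1))).map fun p => bagCodes q.1 q.2.1 q.2.2 (p / (q.2.2.length + 1)) (p % (q.2.2.length + 1))) :=
    hbags0.congr fun q => rfl
  exact (((listOfRaw natE).comp hpar).pair ((listOfRaw (listE natE)).comp hbags)).congr fun q => rfl

end PathFP

/-! ### The supplier of path decompositions -/

open PathFP

/-- The code of the empty decomposition. [folklore] -/
theorem encode_emptyDecomp (C : QCircuit cliffordT 0) (hC : ∀ g ∈ C.gates, g.wires.Nonempty) :
    (emptyDecomp C hC).encode = pairE (listE natE) (listE (listE natE)) ([0], [[]]) := by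
  rw [RootedTreeDecomposition.encode, pairE_eq, listE_eq, listE_eq, listE_eq, natE_eq]
  congr 1
  refine Prod.ext ?_ ?_ <;> simp [List.ofFn_succ, emptyDecomp]

/-- Gates with their wire number (the items of a description). [folklore] -/
abbrev SGate : Type := Σ N : ℕ, QGate cliffordT N

/-- The code of a gate item. [folklore] -/
def sgateE : SGate → List Bool := fun x => x.2.encode

/-- **The wire list is read off the gate code** (`sndF ∘ sndF ∘ drop 1`). [cite: AroraBarak2009, §1.3] -/
theorem wireListOfFP : CodeFP sgateE (rawE natE) (fun x : SGate => wireListOf x.2) := by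
  have hstr : CodeFP strE strE (fun w => sndF (sndF (w.drop 1))) :=
    (of_fn sndF sndF_mem_FP fun _ => rfl).comp ((of_fn sndF sndF_mem_FP fun _ => rfl).comp
      (strDrop.comp ((const _ 1).pair (CodeFP.id strE))))
  obtain ⟨F, hF, hFs⟩ := hstr
  refine ⟨F, hF, fun x => ?_⟩
  obtain ⟨N, g⟩ := x
  have key : ∀ {n : ℕ} (e : Fin n ↪ Fin N) (tag : Bool) (A : List Bool),
      F (tag :: boolPair A (encodingListNatBool.encode (List.ofFn fun i => ((e i : Fin N) : ℕ)))) =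
        rawE natE (List.ofFn fun i => ((e i : Fin N) : ℕ)) := by
    intro n e tag A
    have h := hFs (tag :: boolPair A (encodingListNatBool.encode (List.ofFn fun i => ((e i : Fin N) : ℕ))))
    simp only [strE, id] at h
    rw [h, List.drop_one, List.tail_cons, sndF_boolPair, show (encodingListNatBool.encode : List ℕ → List Bool) = listE natE from
      by rw [listE_eq, natE_eq], listE, sndF_boolPair]
  cases g with
  | gate op e => exact key e false _
  | oracle k e => exact key e true _

variable {F : QCircuitFamily cliffordT}

/-- **The description of `C_n` as typed data**, from uniformity: `(n, ancillas, gate items)`.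
[cite: AroraBarak2009, §6.2 (uniform families)] -/
theorem descFP (hU : F.IsUniform) :
    CodeFP unE (pairE natE (pairE unE (rawE sgateE)))
      (fun n => (n, F.ancillas n, (F.circ n).gates.map fun g => (⟨_, g⟩ : SGate))) :=
  of_fn F.descFn (QCircuitFamily.descFn_mem_FP_of_isUniform hU) fun n => by
    rw [QCircuitFamily.descFn_unaryEncodeNat, QCircuit.sigmaEncode_eq, QCircuit.encode_eq_encList, pairE_apply, pairE_apply]
    simp only [rawE, List.map_map]
    rfl

/-- **The wire lists of `C_n` on codes.** [cite: AroraBarak2009, §1.3] -/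
theorem wlOfFP (hU : F.IsUniform) : CodeFP unE (rawE (rawE natE)) (fun n => wlOf (F.circ n)) := by
  have hm := map (σ := Unit) (eσ := unitE) (eα := sgateE) (eβ := rawE natE) (g := fun t => wireListOf t.2.2)
    (wireListOfFP.comp (snd _ _))
  refine ((hm.comp ((const _ ()).pair (descFP hU).snd'.snd')).congr fun n => ?_)
  simp only [wlOf, List.map_map]
  rfl

/-- The wire number `N = n + ancillas` of `C_n`, unary. [folklore] -/
theorem wireNumFP (hU : F.IsUniform) : CodeFP unE unE (fun n => n + F.ancillas n) :=
  unAdd.comp ((CodeFP.id unE).pair (descFP hU).snd'.fst')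

section Supplier

variable {c : ℕ} {s : List Bool → List Bool}
  (hσ : ∀ n, ∃ σ : Fin (n + F.ancillas n) ≃ Fin (n + F.ancillas n),
    (F.circ n).cutParamUnder σ ≤ c * Nat.log 2 n + c ∧
    s (unaryEncodeNat n) = encodingListNatBool.encode (List.ofFn fun w => ((σ w : Fin (n + F.ancillas n)) : ℕ)))

/-- The supplied ordering (a choice). [folklore] -/
def sigmaOf (n : ℕ) : Fin (n + F.ancillas n) ≃ Fin (n + F.ancillas n) := Classical.choose (hσ n)

/-- Its cut parameter. [folklore] -/
theorem cutParam_sigmaOf (n : ℕ) : (F.circ n).cutParamUnder (sigmaOf hσ n) ≤ c * Nat.log 2 n + c :=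
  (Classical.choose_spec (hσ n)).1

/-- The supplier prints its position list. [folklore] -/
theorem s_eq_posList (n : ℕ) : s (unaryEncodeNat n) = listE natE (posList (sigmaOf hσ n)) := by
  rw [(Classical.choose_spec (hσ n)).2]
  exact congrFun (show (encodingListNatBool.encode : List ℕ → List Bool) = listE natE by rw [listE_eq, natE_eq]) _

/-- **The position list on codes**, from the supplier. [cite: AroraBarak2009, §1.3] -/
theorem posListFP (hs : s ∈ FP) : CodeFP unE (rawE natE) (fun n => posList (sigmaOf hσ n)) :=
  (rawOfList natE).comp (of_fn (eβ := listE natE) s hs fun n => s_eq_posList hσ n)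

/-- **The printed lists**, as a typed function of `n`: the empty decomposition without wires,
else `pathLists`. [folklore] -/
def supplierLists (n : ℕ) : List ℕ × List (List ℕ) :=
  if n + F.ancillas n = 0 then ([0], [[]]) else pathLists (posList (sigmaOf hσ n)) (n + F.ancillas n) (wlOf (F.circ n))

/-- **The printed lists on codes.** [cite: AroraBarak2009, §1.3] -/
theorem supplierListsFP (hU : F.IsUniform) (hs : s ∈ FP) :
    CodeFP unE (pairE (listE natE) (listE (listE natE))) (supplierLists hσ) := by
  have hdat : CodeFP unE datE (fun n => (posList (sigmaOf hσ n), (n + F.ancillas n, wlOf (F.circ n)))) :=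
    (posListFP hσ hs).pair ((wireNumFP hU).pair (wlOfFP hU))
  have hmain := pathListsFP.comp hdat
  have hz : CodeFP unE bitE (fun n => decide (n + F.ancillas n = 0)) := natEq.comp ((natOfUn.comp (wireNumFP hU)).pair (const _ 0))
  refine (hz.ite (const _ (([0], [[]]) : List ℕ × List (List ℕ))) hmain).congr fun n => ?_
  simp only [supplierLists, decide_eq_true_eq]

/-- **The printed lists are the code of a rooted tree decomposition of width `≤ 2r + 1`.**
[cite: MarkovShi2008, §5 (proof of Prop 5.1)] -/
theorem supplierLists_spec (n : ℕ) :
    ∃ (k : ℕ) (D : RootedTreeDecomposition (circuitGraph (F.circ n)) k),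
      D.width ≤ 2 * (c * Nat.log 2 n + c) + 1 ∧
      pairE (listE natE) (listE (listE natE)) (supplierLists hσ n) = D.encode := by
  have hC : ∀ g ∈ (F.circ n).gates, g.wires.Nonempty := fun g _ => wires_nonempty_cliffordT g
  unfold supplierLists
  split_ifs with hN
  · -- no wires
    revert hC
    generalize F.circ n = C
    revert C
    rw [hN]
    intro C hC
    exact ⟨1, emptyDecomp C hC, by rw [width_emptyDecomp]; exact Nat.zero_le _, (encode_emptyDecomp C hC).symm⟩
  · have hNpos : 0 < n + F.ancillas n := Nat.pos_of_ne_zero hN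
    refine ⟨_, pathDecomp (sigmaOf hσ n) (F.circ n) hNpos hC, ?_, ?_⟩
    · exact (width_pathDecomp_le _ _ hNpos hC).trans (by have := cutParam_sigmaOf hσ n; omega)
    · rw [encode_pathDecomp]
      simp only [pathLists, wlOf, List.length_map]

include hσ in
/-- **The supplier of path decompositions**: for a uniform family and an `FP` supplier of
orderings of cut parameter `≤ c·log₂ n + c`, an `FP` function `1ⁿ ↦ 𝒯_n` supplies rooted tree
decompositions of the circuit graphs of width `≤ (2c+2)·log₂ n + (2c+2)`.
[cite: MarkovShi2008, §5 (proof of Prop 5.1)] [cite: AroraBarak2009, §1.3] -/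
theorem exists_pathSupplier (hU : F.IsUniform) (hs : s ∈ FP) :
    ∃ d : List Bool → List Bool, d ∈ FP ∧ ∀ n,
      ∃ (k : ℕ) (D : RootedTreeDecomposition (circuitGraph (F.circ n)) k),
        D.width ≤ (2 * c + 2) * Nat.log 2 n + (2 * c + 2) ∧ d (unaryEncodeNat n) = D.encode := by
  obtain ⟨d, hd, hdg⟩ := supplierListsFP hσ hU hs
  refine ⟨d, hd, fun n => ?_⟩
  obtain ⟨k, D, hw, hD⟩ := supplierLists_spec hσ n
  refine ⟨k, D, hw.trans ?_, ?_⟩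
  · have h1 : (2 * c + 2) * Nat.log 2 n = 2 * (c * Nat.log 2 n) + 2 * Nat.log 2 n := by ring
    omega
  · rw [← hD, ← hdg]

end Supplier

/-- **Markov–Shi's Prop 5.1 (ordering supplied) from Thm 4.6 (decomposition supplied)**: the
contraction theorem `markovShi2008_thm46` implies `markovShi2008_prop51` — the supplied ordering
yields, in polynomial time, the rooted path decomposition of the printed proof
(`exists_pathSupplier`), with no Robertson–Seymour step. [cite: MarkovShi2008, §5 (Prop 5.1) and §4 (Thm 4.6)] -/
theorem markovShi2008_prop51_of_thm46' (h : markovShi2008_thm46) : markovShi2008_prop51 := by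
  rintro c F L hOF hU hPS ⟨s, hs, hσ⟩ hDec
  exact h (2 * c + 2) F L hOF hU hPS (exists_pathSupplier hσ hU hs) hDec

end Literature.Barriers.QuantumAdvantage

end
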